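import Summits.AnomalousDissipation.AnomalousDissipation.Theorems.SawtoothPulseCascadeK1LocalisedCascadeCornerTraceSumNeg

/-!
# K1loc, line `Spectral` / thin start — helper: COEFFICIENTS OF (CHIRP × TRIGONOMETRIC POLYNOMIAL) (S-D constants, «CT» glue)

Helper file of the prover lane on the crux `K1LocalisedCascade` (stmt-AnomalousDissipation-19491), route
`SawtoothPulseCascade` (S-D fibre ledger; arbiter A23-12 (iv)(a), glue for the CT iterate twin).  The corner-trace bound
`…CornerTraceSum.cornerTrace_sum_sq_le` is stated on the coefficient convolution `Σ_{l∈S} c_l ĝ(k−l)`; on a fibre of the half-step the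
object is the Fourier coefficient of the PRODUCT of the chirp `g` with the tracked trigonometric polynomial `T = Σ_{l∈S} c_l e_l`.
**`fourierCoeff_mul_trigPoly`**: `𝓕(g·T)(k) = Σ_{l∈S} c_l·ĝ(k−l)` for continuous `g` (shift rule `𝓕(e_l g)(k) = ĝ(k−l)`), and
`fourierCoeff_fourier_mul`: the shift rule itself.  No definitions; nothing about the crux. [cite: Grafakos2014, Prop. 3.1.2 (5)] [problem: turb]
-/

-- `Summit.<Summit>.<Problem>`: single-conjunct summit, the duplicate namespace segment is deliberate.
set_option linter.dupNamespace false

noncomputable section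

namespace Summit.AnomalousDissipation.AnomalousDissipation.Theorems.SawtoothPulseCascade.K1Window

open MeasureTheory Set Filter Topology Function Complex AddCircle
open scoped Real

/-- **Shift rule on the circle**: `𝓕(e_l·g)(k) = ĝ(k − l)` for continuous `g`. [cite: Grafakos2014, Prop. 3.1.2 (5)] -/
theorem fourierCoeff_fourier_mul {g : UnitAddCircle → ℂ} (l k : ℤ) :
    fourierCoeff (fun x : UnitAddCircle => (fourier l x : ℂ) * g x) k = fourierCoeff g (k - l) := by
  simp only [fourierCoeff, smul_eq_mul]
  refine integral_congr_ae (Eventually.of_forall fun x => ?_)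
  simp only
  rw [← mul_assoc, ← fourier_add]
  congr 2
  ring

/-- **Coefficients of chirp × trigonometric polynomial**: for continuous `g` and `T = Σ_{l∈S} c_l e_l`,
`𝓕(g·T)(k) = Σ_{l∈S} c_l·ĝ(k − l)`. [cite: Grafakos2014, Prop. 3.1.2 (5)] -/
theorem fourierCoeff_mul_trigPoly {g : UnitAddCircle → ℂ} (hg : Continuous g) (c : ℤ → ℂ) (S : Finset ℤ) (k : ℤ) :
    fourierCoeff (fun x : UnitAddCircle => g x * ∑ l ∈ S, c l * fourier l x) k = ∑ l ∈ S, c l * fourierCoeff g (k - l) := by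
  have hI : ∀ l : ℤ, Integrable (fun x : UnitAddCircle => (fourier (-k) x : ℂ) • (c l * ((fourier l x : ℂ) * g x))) haarAddCircle :=
    fun l => ((fourier (-k)).continuous.smul (continuous_const.mul ((fourier l).continuous.mul hg))).integrable_of_hasCompactSupport
      (HasCompactSupport.of_compactSpace _)
  have e1 : (fun x : UnitAddCircle => g x * ∑ l ∈ S, c l * fourier l x) =
      fun x => ∑ l ∈ S, c l * ((fourier l x : ℂ) * g x) := by
    funext x; rw [Finset.mul_sum]; refine Finset.sum_congr rfl fun l _ => ?_; ring
  rw [e1]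
  simp only [fourierCoeff]
  rw [show (fun x : UnitAddCircle => (fourier (-k) x : ℂ) • ∑ l ∈ S, c l * ((fourier l x : ℂ) * g x)) =
      fun x => ∑ l ∈ S, (fourier (-k) x : ℂ) • (c l * ((fourier l x : ℂ) * g x)) by funext x; rw [Finset.smul_sum],
    integral_finsetSum S (fun l _ => hI l)]
  refine Finset.sum_congr rfl fun l _ => ?_
  have h := fourierCoeff_fourier_mul (g := g) l k
  simp only [fourierCoeff] at h
  rw [← h, ← smul_eq_mul (c l), ← integral_smul]
  refine integral_congr_ae (Eventually.of_forall fun x => ?_)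
  simp only [smul_eq_mul]
  ring

end Summit.AnomalousDissipation.AnomalousDissipation.Theorems.SawtoothPulseCascade.K1Window
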